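import Summits.BirchSwinnertonDyer.Rank1Residual.ManinAdditive.Gamma1LatticeBalancedCuspDifferencesPrime
import Summits.BirchSwinnertonDyer.Rank1Residual.ManinAdditive.PlusIndexLaws
import Summits.BirchSwinnertonDyer.BirchSwinnertonDyer.Theorems.ManinLocalTwoThreeTameUnitTwistFourier
import Literature.NumberTheory.EllipticCurves.PAdicLFunctionDistributionProofs
import Literature.NumberTheory.EllipticCurves.ModularSymbolsEichlerShimuraHoldsProofs
import HarnessLib

/-!
# E-es-87♭ PROVED: at `3 ∣ N`, plus index prime to `3` ⟹ a tame even UNIT twist of prime conductor exists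
# (`TameUnitTwistOfPlusIndexPrimeToThree`, es g22 / MEMO-es §36.5; typer ask T-es-29 (c))

Summit `BirchSwinnertonDyer`, route `ManinLocalTwoThree` (cell bsd-f2-manin), crux C3 `ManinPrimeToThreeAtNine`
(stmt-BirchSwinnertonDyer-22968).  es's law **E-es-87♭** (HOME/es/Sketch-es-g22.lean §3, sha16 20af58d791d39f75, with the
`coeffField f = ⊥` binder of the 19:58Z erratum) is proved here with its signature VERBATIM
(`tameUnitTwistOfPlusIndexPrimeToThree`), together with **E-es-87♭⁺ at `4 ∣ N`** (`oddTameUnitTwistOfPlusIndexPrimeToThree_of_four_dvd`: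
the twist has ODD order).  Statement: for a newform `f ∈ S₂(Γ₀(N))` with rational coefficients, `3 ∣ N` and plus index
`[Λ_f⁺ : Λ₁(f)⁺]` prime to `3` (`PlusIndexPrimeTo 3 f`), there are a modulus `m` prime to `3N`, a primitive even Dirichlet
character `χ ≠ 1` mod `m` of order prime to `3` and `r ∈ ℂ` with `Σ_a χ(a){∞, a/m}_f = r · Ω⁺_f` and `s·r/3` NOT an algebraic
integer for every `3 ∤ s` (`r` is a unit at some prime above `3`).

PROOF (MEMO-es §36.5, with step (4) replaced by the prime-ideal-free span lemma of the sibling file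
`…TameUnitTwistFourier`): (1) `re Λ_f = ℤ·Ω⁺/2` (`plusPeriod_pos_and_realPeriods_eq`, Eichler–Shimura + conjugation, tree
theorems), so every `x ∈ Λ_f` has `x + x̄ = k·Ω⁺`, `k ∈ ℤ`, and some `x₀` has `x₀ + x̄₀ = Ω⁺`; (2) THEOREM B′
(`periodLatticeGamma1_eq_closure_balancedCuspDiffsPrime`, `ε = −1`, `n₀ = 3N`): `Λ₁(f)` is generated by the balanced cusp
differences `{∞, b/m} − {∞, b'/m}` at primes `m ≡ −1 (mod N)`, `m > 3N`; if all of them had plus part in `3ℤ·Ω⁺` so would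
`Λ₁(f)` (closure induction), contradicting `PlusIndexPrimeTo 3 f` at `x₀`; (3) at that `m`: `y_a := {∞, a/m} − {∞, 0} ∈ Λ_f`
(Lemma A `exists_gamma0_modularSymbol_div`), `F(a) := (y_a + ȳ_a)/Ω⁺ ∈ ℤ` is even (`{∞, −r} = conj {∞, r}`, real coefficients)
and NOT constant mod `3` on the units; (4) `3 ∤ φ(m) = m − 1` (`m ≡ −1 (mod 3)`), so the span lemma
`Int.dvd_sub_of_forall_isIntegral_charSum_div` yields `χ ≠ 1` with `s·F̂(χ)/3` never an algebraic integer (`3 ∤ s`); `χ` is even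
since `F̂` of an odd character vanishes; (5) half-sum identity `2·S_χ = Ω⁺·F̂(χ)` (`Σ_a χ(a) = 0`, reindex `a ↦ −a`), so
`r = F̂(χ)/2`; (6) `χ` is primitive (prime modulus), `ord χ ∣ m − 1` is prime to `3`, `(m, 3N) = 1` as `m > 3N` is prime; at
`4 ∣ N`, `m ≡ 3 (mod 4)` and `χ` even give `ord χ ∣ (m−1)/2` odd (Euler's criterion).

HONEST FRAMING: an f-level theorem about period lattices of rational newforms (no curve, no Manin constant); it discharges the
«E-es-87♭ PROVED» half of the C3 LEAD's v18 reshape criterion (STATUS 2026-08-28T19:57:06Z) and makes es's corollary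
`not_three_dvd_maninConstant_of_e87pm_of_kp` unconditional in E-es-87♭ on `4 ∣ N ∨ ā = 0` (still modulo the Literature fact
F₃♮).  C3, Manin's conjecture and BSD are NOT proved by this.  No definitions, no named facts, no sorry.
-/

set_option linter.dupNamespace false
set_option autoImplicit false

noncomputable section

open scoped Classical MatrixGroups ModularForm ComplexConjugate

open CongruenceSubgroup Complex Literature.NumberTheory.EllipticCurves
  Literature.NumberTheory.EllipticCurves.ModularForms
  Summit.BirchSwinnertonDyer.Rank1Residual.ManinAdditive.Gamma1Lattice
  Summit.BirchSwinnertonDyer.Rank1Residual.ManinAdditive.KatoCurve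

namespace Summit.BirchSwinnertonDyer.BirchSwinnertonDyer.Theorems.ManinLocalTwoThree

variable {N : ℕ} [NeZero N] {f : CuspForm (Gamma0 N) 2}

/-! ### §1 Plus parts of periods of a rational newform -/

/-- For a rational newform, every period `x ∈ Λ_f` has plus part `x + x̄ = k · Ω⁺_f` with `k ∈ ℤ`
(`re Λ_f = ℤ · Ω⁺_f/2`). [cite: CremonaAlgorithms1997, §2.8] -/
theorem exists_int_add_conj_eq_mul_plusPeriod (hf : IsNewform0 f) (hQ : coeffField f = ⊥) {x : ℂ}
    (hx : x ∈ periodLattice f) : ∃ k : ℤ, x + conj x = (k : ℂ) * (plusPeriod f : ℂ) := by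
  obtain ⟨-, hre⟩ := plusPeriod_pos_and_realPeriods_eq isZLattice_periodLattice_holds hf hQ
  have hxre : x.re ∈ realPeriods f := AddSubgroup.mem_map_of_mem Complex.reLm.toAddMonoidHom hx
  rw [hre, AddSubgroup.mem_zmultiples_iff] at hxre
  obtain ⟨k, hk⟩ := hxre
  refine ⟨k, ?_⟩
  rw [Complex.add_conj, ← hk, zsmul_eq_mul]
  push_cast
  ring

/-- For a rational newform some period has plus part exactly `Ω⁺_f` (`Ω⁺_f/2 ∈ re Λ_f`). [cite: CremonaAlgorithms1997, §2.8] -/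
theorem exists_mem_periodLattice_add_conj_eq_plusPeriod (hf : IsNewform0 f) (hQ : coeffField f = ⊥) :
    ∃ x ∈ periodLattice f, x + conj x = (plusPeriod f : ℂ) := by
  obtain ⟨-, hre⟩ := plusPeriod_pos_and_realPeriods_eq isZLattice_periodLattice_holds hf hQ
  have hmem : plusPeriod f / 2 ∈ realPeriods f := by rw [hre]; exact AddSubgroup.mem_zmultiples _
  obtain ⟨x, hx, hxre⟩ := AddSubgroup.mem_map.mp hmem
  refine ⟨x, hx, ?_⟩
  rw [Complex.add_conj]
  have : x.re = plusPeriod f / 2 := hxre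
  rw [this]
  push_cast
  ring

/-! ### §2 From the plus index to ONE balanced prime-conductor difference with plus part `≢ 0 (mod 3Ω⁺)` -/

/-- If the plus index `[Λ_f⁺ : Λ₁(f)⁺]` is prime to `3`, then for every `n₀` some balanced cusp difference
`z = {∞, b/m}_f − {∞, b'/m}_f` at a prime `m > n₀`, `m ≡ −1 (mod N)`, has plus part `z + z̄ = j·Ω⁺_f` with `3 ∤ j`
(THEOREM B′ + closure induction). -/
theorem exists_balancedCuspDiffsPrime_plus_not_three_dvd (hf : IsNewform0 f) (hQ : coeffField f = ⊥) (hN : 2 ≤ N)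
    (hd : PlusIndexPrimeTo 3 f) (n₀ : ℕ) :
    ∃ z ∈ balancedCuspDiffsPrime f n₀ (-1), ∃ j : ℤ, z + conj z = (j : ℂ) * (plusPeriod f : ℂ) ∧ ¬ (3 : ℤ) ∣ j := by
  obtain ⟨hpos, -⟩ := plusPeriod_pos_and_realPeriods_eq isZLattice_periodLattice_holds hf hQ
  have hΩ : (plusPeriod f : ℂ) ≠ 0 := by exact_mod_cast hpos.ne'
  by_contra hcon
  push Not at hcon
  have hB := periodLatticeGamma1_eq_closure_balancedCuspDiffsPrime f hN n₀ (ε := -1) (Or.inr rfl)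
  -- every element of `Λ₁(f)` has plus part in `3ℤ·Ω⁺`
  have hall : ∀ y ∈ periodLatticeGamma1 f, ∃ j : ℤ, y + conj y = (j : ℂ) * (plusPeriod f : ℂ) ∧ (3 : ℤ) ∣ j := by
    intro y hy
    rw [hB] at hy
    induction hy using AddSubgroup.closure_induction with
    | mem z hz =>
      have hzΛ : z ∈ periodLattice f := by
        have hz1 : z ∈ periodLatticeGamma1 f := by rw [hB]; exact AddSubgroup.subset_closure hz
        exact periodLatticeGamma1_le_periodLattice f hz1
      obtain ⟨j, hj⟩ := exists_int_add_conj_eq_mul_plusPeriod hf hQ hzΛ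
      exact ⟨j, hj, hcon z hz j hj⟩
    | zero => exact ⟨0, by simp, dvd_zero _⟩
    | add x y _ _ hx hy =>
      obtain ⟨j₁, hj₁, h₁⟩ := hx
      obtain ⟨j₂, hj₂, h₂⟩ := hy
      refine ⟨j₁ + j₂, ?_, dvd_add h₁ h₂⟩
      rw [map_add, Int.cast_add, add_mul, ← hj₁, ← hj₂]; ring
    | neg x _ hx =>
      obtain ⟨j, hj, h⟩ := hx
      refine ⟨-j, ?_, (dvd_neg).mpr h⟩
      rw [map_neg, Int.cast_neg, neg_mul, ← hj]; ring
  obtain ⟨x₀, hx₀, hx₀Ω⟩ := exists_mem_periodLattice_add_conj_eq_plusPeriod hf hQ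
  obtain ⟨y, hy, k, hk3, hk⟩ := hd x₀ hx₀
  obtain ⟨j, hj, hj3⟩ := hall y hy
  rw [hx₀Ω, hj] at hk
  have hkj : (k : ℤ) = j := by
    have h1 : ((k : ℤ) : ℂ) = (j : ℂ) := by
      have := mul_right_cancel₀ hΩ hk
      exact_mod_cast this
    exact_mod_cast h1
  exact hk3 (Int.natCast_dvd_natCast.mp (hkj ▸ hj3))

/-! ### §3 The integer-valued even function `a ↦ ({0, a/m}_f + conj)/Ω⁺` on `ℤ/m` -/

section PrimeConductor

variable (f) {m : ℕ} [Fact m.Prime]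

omit [NeZero N] in
/-- `y_0 = 0` for `y_a := {∞, a/m}_f − {∞, 0}_f` (representative `a.val ∈ [0, m)`). -/
private theorem ySymb_zero : modularSymbol f (((0 : ZMod m).val : ℚ) / m) - modularSymbol f 0 = 0 := by
  simp [ZMod.val_zero]

/-- `y_a ∈ Λ_f` (Lemma A: `{∞, b/m} = {∞, δ∞} + {∞, 0}` for `gcd(b, m) = gcd(N, m) = 1`). -/
private theorem ySymb_mem_periodLattice (hNm : IsCoprime (N : ℤ) m) (a : ZMod m) :
    modularSymbol f ((a.val : ℚ) / m) - modularSymbol f 0 ∈ periodLattice f := by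
  by_cases ha : a = 0
  · rw [ha, ySymb_zero]; exact zero_mem _
  · have hm : (m : ℤ) ≠ 0 := by exact_mod_cast (Fact.out : m.Prime).ne_zero
    have hval : 0 < a.val := Nat.pos_of_ne_zero ((ZMod.val_ne_zero a).mpr ha)
    have hcop : IsCoprime (a.val : ℤ) (m : ℤ) := by
      rw [Nat.isCoprime_iff_coprime]
      exact (Nat.coprime_of_lt_prime hval.ne' (ZMod.val_lt a) Fact.out).symm
    obtain ⟨δ, -, -, hδ⟩ := exists_gamma0_modularSymbol_div f hm hcop hNm
    have e : ((a.val : ℤ) : ℚ) / ((m : ℤ) : ℚ) = (a.val : ℚ) / m := by push_cast; rfl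
    rw [e] at hδ
    rw [hδ, add_sub_cancel_right]
    exact cuspSymbol_mem_periodLattice f δ

/-- `y_{−a} = conj y_a` for `f` with real coefficients (`{∞, (m − a)/m} = {∞, −a/m} = conj {∞, a/m}`). -/
private theorem ySymb_neg (hreal : ∀ n, (cuspCoeff f n).im = 0) (a : ZMod m) :
    modularSymbol f (((-a).val : ℚ) / m) - modularSymbol f 0 = conj (modularSymbol f ((a.val : ℚ) / m) - modularSymbol f 0) := by
  have h0 : conj (modularSymbol f 0) = modularSymbol f 0 := by
    have := modularSymbol_neg_eq_conj_holds f hreal 0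
    rw [neg_zero] at this
    exact this.symm
  by_cases ha : a = 0
  · rw [ha, neg_zero, ySymb_zero, map_zero]
  · have hval : (-a).val = m - a.val := by rw [ZMod.neg_val, if_neg ha]
    have hlt : a.val ≤ m := (ZMod.val_lt a).le
    have hmQ : (m : ℚ) ≠ 0 := by exact_mod_cast (Fact.out : m.Prime).ne_zero
    have e : (((-a).val : ℚ) / m) = -((a.val : ℚ) / m) + ((1 : ℤ) : ℚ) := by
      rw [hval, Nat.cast_sub hlt]
      field_simp
      push_cast
      ring
    rw [e, modularSymbol_add_intCast_holds f, modularSymbol_neg_eq_conj_holds f hreal, map_sub, h0]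

/-- `{∞, b/m}_f = {∞, (b mod m)/m}_f` (translation invariance). -/
private theorem modularSymbol_intCast_div_eq (b : ℤ) :
    modularSymbol f ((b : ℚ) / ((m : ℤ) : ℚ)) = modularSymbol f ((((b : ZMod m)).val : ℚ) / m) := by
  have hmZ : (m : ℤ) ≠ 0 := by exact_mod_cast (Fact.out : m.Prime).ne_zero
  have hmQ : (m : ℚ) ≠ 0 := by exact_mod_cast (Fact.out : m.Prime).ne_zero
  have hv : (((b : ZMod m)).val : ℤ) = b % m := ZMod.val_intCast b
  have hb : (b : ℚ) / ((m : ℤ) : ℚ) = ((((b : ZMod m)).val : ℚ) / m) + ((b / m : ℤ) : ℚ) := by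
    have e1 : (b : ℚ) = ((b % m : ℤ) : ℚ) + (m : ℚ) * ((b / m : ℤ) : ℚ) := by
      exact_mod_cast (Int.emod_add_mul_ediv b m).symm
    have e2 : ((((b : ZMod m)).val : ℚ)) = ((b % m : ℤ) : ℚ) := by exact_mod_cast hv
    rw [e2, e1]
    field_simp
    push_cast
    ring
  rw [hb, modularSymbol_add_intCast_holds f]

/-- **Half-sum identity.** For a non-trivial EVEN Dirichlet character `χ` mod a prime `m` and `f` with real coefficients,
`2 · Σ_a χ(a){∞, a/m}_f = Σ_a χ(a)·(y_a + ȳ_a)` (`Σ_a χ(a) = 0` removes `{∞, 0}`; reindex `a ↦ −a`). -/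
private theorem two_mul_twistedSymbolSum_eq (hreal : ∀ n, (cuspCoeff f n).im = 0) {χ : DirichletCharacter ℂ m}
    (hχ : χ ≠ 1) (hev : χ.Even) :
    2 * twistedSymbolSum f χ = ∑ a : ZMod m, χ a * ((modularSymbol f ((a.val : ℚ) / m) - modularSymbol f 0) + conj (modularSymbol f ((a.val : ℚ) / m) - modularSymbol f 0)) := by
  have hS : twistedSymbolSum f χ = ∑ a : ZMod m, χ a * (modularSymbol f ((a.val : ℚ) / m) - modularSymbol f 0) := by
    have : ∑ a : ZMod m, χ a * (modularSymbol f ((a.val : ℚ) / m) - modularSymbol f 0) =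
        ∑ a : ZMod m, χ a * modularSymbol f ((a.val : ℚ) / m) - (∑ a : ZMod m, χ a) * modularSymbol f 0 := by
      simp only [mul_sub, Finset.sum_sub_distrib, Finset.sum_mul]
    rw [this, χ.sum_eq_zero_of_ne_one hχ, zero_mul, sub_zero]
    rfl
  have hS' : twistedSymbolSum f χ = ∑ a : ZMod m, χ a * conj (modularSymbol f ((a.val : ℚ) / m) - modularSymbol f 0) := by
    rw [hS]
    refine Fintype.sum_equiv (Equiv.neg (ZMod m)) _ _ fun a ↦ ?_
    rw [Equiv.neg_apply, hev.eval_neg, ySymb_neg f hreal, Complex.conj_conj]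
  rw [two_mul]
  nth_rewrite 1 [hS]
  rw [hS', ← Finset.sum_add_distrib]
  refine Finset.sum_congr rfl fun a _ ↦ ?_
  ring

end PrimeConductor

omit [NeZero N] in
/-- `(m : ZMod N) = −1` (as an integer cast) gives `N ∣ m + 1`. [folklore] -/
theorem nat_dvd_succ_of_zmod_eq_neg_one {m : ℕ} (h : ((m : ℤ) : ZMod N) = -1) : N ∣ m + 1 := by
  have h0 : (((m + 1 : ℕ) : ℤ) : ZMod N) = 0 := by
    have h' : ((m : ℕ) : ZMod N) = -1 := by exact_mod_cast h
    push_cast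
    rw [h', neg_add_cancel]
  exact Int.natCast_dvd_natCast.mp ((ZMod.intCast_zmod_eq_zero_iff_dvd _ N).mp h0)

/-! ### §4 The core: a prime `m ≡ −1 (mod N)`, `m > 3N`, and an even `χ ≠ 1` mod `m` with `S_χ = r·Ω⁺`, `s·r/3` never integral -/

/-- **Core of E-es-87♭.** For a rational newform `f` on `Γ₀(N)`, `3 ∣ N`, with plus index prime to `3`: a prime `m > 3N`,
`m ≡ −1 (mod N)`, an even Dirichlet character `χ ≠ 1` mod `m` and `r` with `S_χ = r·Ω⁺_f` and `s·r/3` not an algebraic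
integer for all `3 ∤ s`. -/
theorem exists_prime_even_character_unit_twist (hf : IsNewform0 f) (hQ : coeffField f = ⊥) (h3 : 3 ∣ N)
    (hd : PlusIndexPrimeTo 3 f) :
    ∃ (m : ℕ) (_ : Fact m.Prime) (χ : DirichletCharacter ℂ m) (r : ℂ), 3 * N < m ∧ ((m : ℤ) : ZMod N) = -1 ∧
      χ ≠ 1 ∧ χ.Even ∧ twistedSymbolSum f χ = r * (plusPeriod f : ℂ) ∧
      ∀ s : ℕ, ¬ 3 ∣ s → ¬ IsIntegral ℤ ((s : ℂ) * r / 3) := by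
  have hN0 : N ≠ 0 := NeZero.ne N
  have hN3 : 3 ≤ N := Nat.le_of_dvd (Nat.pos_of_ne_zero hN0) h3
  have hN : 2 ≤ N := le_trans (by norm_num) hN3
  obtain ⟨hpos, -⟩ := plusPeriod_pos_and_realPeriods_eq isZLattice_periodLattice_holds hf hQ
  have hΩ : (plusPeriod f : ℂ) ≠ 0 := by exact_mod_cast hpos.ne'
  have hreal : ∀ n, (cuspCoeff f n).im = 0 := cuspCoeff_im_eq_zero_of_coeffField_eq_bot hQ
  -- §2: one balanced prime-conductor difference with plus part not in `3ℤΩ⁺`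
  obtain ⟨z, ⟨m, b, b', hmp, hmn, hmN, hb, hb', rfl⟩, j, hj, hj3⟩ :=
    exists_balancedCuspDiffsPrime_plus_not_three_dvd hf hQ hN hd (3 * N)
  haveI : Fact m.Prime := ⟨hmp⟩
  have hmN' : ((m : ℤ) : ZMod N) = -1 := by rw [hmN]; push_cast; rfl
  have hNm : IsCoprime (N : ℤ) m := isCoprime_of_pm_one (Or.inr hmN')
  -- §3: the integer-valued even function `F`
  have hF : ∀ a : ZMod m, ∃ k : ℤ, (modularSymbol f ((a.val : ℚ) / m) - modularSymbol f 0) + conj (modularSymbol f ((a.val : ℚ) / m) - modularSymbol f 0) = (k : ℂ) * (plusPeriod f : ℂ) :=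
    fun a ↦ exists_int_add_conj_eq_mul_plusPeriod hf hQ (ySymb_mem_periodLattice f hNm a)
  choose F hF using hF
  have hFeven : ∀ a : ZMod m, F (-a) = F a := by
    intro a
    have h1 := hF (-a)
    rw [ySymb_neg f hreal, Complex.conj_conj, add_comm, hF a] at h1
    exact_mod_cast (mul_right_cancel₀ hΩ h1).symm
  -- `F b − F b' = j`, not divisible by `3`
  have hzF : (j : ℂ) * (plusPeriod f : ℂ) = ((F (b : ZMod m) - F (b' : ZMod m) : ℤ) : ℂ) * (plusPeriod f : ℂ) := by
    rw [← hj, modularSymbol_intCast_div_eq f b, modularSymbol_intCast_div_eq f b']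
    have e : modularSymbol f ((((b : ZMod m)).val : ℚ) / m) - modularSymbol f ((((b' : ZMod m)).val : ℚ) / m) =
        (modularSymbol f ((((b : ZMod m)).val : ℚ) / m) - modularSymbol f 0) -
          (modularSymbol f ((((b' : ZMod m)).val : ℚ) / m) - modularSymbol f 0) := by ring
    rw [e, map_sub, Int.cast_sub, sub_mul, ← hF, ← hF]
    ring
  have hjF : j = F (b : ZMod m) - F (b' : ZMod m) := by
    have := mul_right_cancel₀ hΩ hzF
    exact_mod_cast this
  have hunit : IsUnit ((b : ℤ) : ZMod m) := (ZMod.coe_int_isUnit_iff_isCoprime b m).mpr hb.symm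
  have hunit' : IsUnit ((b' : ℤ) : ZMod m) := (ZMod.coe_int_isUnit_iff_isCoprime b' m).mpr hb'.symm
  -- `3 ∤ φ(m) = m − 1` since `m ≡ −1 (mod 3)`
  have hm3 : ¬ 3 ∣ m.totient := by
    rw [Nat.totient_prime hmp]
    have h3m : 3 ∣ m + 1 := dvd_trans h3 (nat_dvd_succ_of_zmod_eq_neg_one hmN')
    have h1m := hmp.one_le
    intro h
    omega
  -- §4: the span lemma, contrapositively
  have hex : ∃ χ : DirichletCharacter ℂ m, χ ≠ 1 ∧
      ∀ s : ℕ, ¬ 3 ∣ s → ¬ IsIntegral ℤ ((s : ℂ) * (∑ a : ZMod m, χ a * (F a : ℂ)) / (3 : ℕ)) := by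
    by_contra hcon
    push Not at hcon
    have := Int.dvd_sub_of_forall_isIntegral_charSum_div Nat.prime_three hm3 F
      (fun χ hχ ↦ hcon χ hχ) hunit hunit'
    exact hj3 (hjF ▸ (by exact_mod_cast this))
  obtain ⟨χ, hχ1, hχ⟩ := hex
  -- `χ` is even: the transform of an odd character of the even `F` vanishes
  have hev : χ.Even := by
    rcases χ.even_or_odd with h | h
    · exact h
    · exfalso
      have hzero : ∑ a : ZMod m, χ a * (F a : ℂ) = 0 := by
        have hneg : ∑ a : ZMod m, χ a * (F a : ℂ) = -∑ a : ZMod m, χ a * (F a : ℂ) := by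
          rw [← Finset.sum_neg_distrib]
          refine Fintype.sum_equiv (Equiv.neg (ZMod m)) _ _ fun a ↦ ?_
          rw [Equiv.neg_apply, h.eval_neg, hFeven]; ring
        have := add_eq_zero_iff_eq_neg.mpr hneg
        rw [← two_mul] at this
        exact (mul_eq_zero.mp this).resolve_left two_ne_zero
      refine hχ 1 (by norm_num) ?_
      rw [hzero, mul_zero, zero_div]
      exact isIntegral_zero
  -- §5: half-sum identity, `r = F̂(χ)/2`
  refine ⟨m, ⟨hmp⟩, χ, (∑ a : ZMod m, χ a * (F a : ℂ)) / 2, hmn, hmN', hχ1, hev, ?_, ?_⟩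
  · have h2 := two_mul_twistedSymbolSum_eq f hreal hχ1 hev
    simp_rw [hF, ← mul_assoc, ← Finset.sum_mul] at h2
    have : twistedSymbolSum f χ = (∑ a : ZMod m, χ a * (F a : ℂ)) * (plusPeriod f : ℂ) / 2 := by
      rw [← h2]; ring
    rw [this]; ring
  · intro s hs hI
    refine hχ s hs ?_
    have e : ((s : ℂ) * (∑ a : ZMod m, χ a * (F a : ℂ)) / (3 : ℕ)) =
        ((2 : ℤ) : ℂ) * ((s : ℂ) * ((∑ a : ZMod m, χ a * (F a : ℂ)) / 2) / 3) := by push_cast; ring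
    rw [e]
    exact IsIntegral.mul (by simpa using isIntegral_algebraMap (R := ℤ) (A := ℂ) (x := (2 : ℤ))) hI

/-! ### §5 Bookkeeping at a prime modulus: primitivity, order, coprimality -/

/-- A non-trivial character of PRIME modulus is primitive. [folklore] -/
theorem DirichletCharacter.isPrimitive_of_prime {m : ℕ} [Fact m.Prime] {χ : DirichletCharacter ℂ m} (hχ : χ ≠ 1) :
    χ.IsPrimitive := by
  rcases (Fact.out : m.Prime).eq_one_or_self_of_dvd _ χ.conductor_dvd_level with h | h
  · exact absurd (χ.eq_one_iff_conductor_eq_one.mpr h) hχ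
  · exact h

/-- `χ ^ φ(m) = 1` for every Dirichlet character mod `m`; hence `ord χ ∣ φ(m)`. [folklore] -/
theorem DirichletCharacter.orderOf_dvd_totient {m : ℕ} [NeZero m] (χ : DirichletCharacter ℂ m) :
    orderOf χ ∣ m.totient := by
  refine orderOf_dvd_of_pow_eq_one (MulChar.ext fun u ↦ ?_)
  rw [MulChar.pow_apply_coe, ← map_pow, ← Units.val_pow_eq_pow_val, ZMod.pow_totient, Units.val_one, map_one,
    MulChar.one_apply_coe]

/-- An EVEN character of odd prime modulus `m` satisfies `χ ^ ((m−1)/2) = 1` (Euler's criterion `u^{(m−1)/2} = ±1`);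
hence `ord χ ∣ m / 2`. [folklore] -/
theorem DirichletCharacter.orderOf_dvd_div_two_of_even {m : ℕ} [Fact m.Prime] {χ : DirichletCharacter ℂ m}
    (hev : χ.Even) : orderOf χ ∣ m / 2 := by
  refine orderOf_dvd_of_pow_eq_one (MulChar.ext fun u ↦ ?_)
  rw [MulChar.pow_apply_coe, ← map_pow, MulChar.one_apply_coe]
  rcases ZMod.pow_div_two_eq_neg_one_or_one m (Units.ne_zero u) with h | h
  · rw [h, map_one]
  · rw [h]; exact hev

/-! ### §6 E-es-87♭ and E-es-87♭⁺ (at `4 ∣ N`) -/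

/-- **E-es-87♭ `TameUnitTwistOfPlusIndexPrimeToThree` — PROVED** (es g22, MEMO-es §36.5; HOME/es/Sketch-es-g22.lean §3 signature
verbatim): for a rational newform `f ∈ S₂(Γ₀(N))` with `3 ∣ N` and plus index `[Λ_f⁺ : Λ₁(f)⁺]` prime to `3`, some tame even
primitive non-trivial `χ` of conductor `m` prime to `3N` and order prime to `3` has `Σ_a χ(a){∞, a/m}_f = r·Ω⁺_f` with `s·r/3`
NOT an algebraic integer for every `3 ∤ s`. -/
theorem tameUnitTwistOfPlusIndexPrimeToThree :
    ∀ {N : ℕ} [NeZero N] (f : CuspForm (Gamma0 N) 2), IsNewform0 f → coeffField f = ⊥ → 3 ∣ N →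
    PlusIndexPrimeTo 3 f →
    ∃ (m : ℕ) (_ : NeZero m) (χ : DirichletCharacter ℂ m) (r : ℂ),
      m.Coprime (3 * N) ∧ χ.IsPrimitive ∧ χ ≠ 1 ∧ ¬ 3 ∣ orderOf χ ∧ χ.Even ∧
      twistedSymbolSum f χ = r * (plusPeriod f : ℂ) ∧
      ∀ s : ℕ, ¬ 3 ∣ s → ¬ _root_.IsIntegral ℤ ((s : ℂ) * r / 3) := by
  intro N _ f hf hQ h3 hd
  obtain ⟨m, hm, χ, r, hmn, hmN, hχ1, hev, hr, hu⟩ := exists_prime_even_character_unit_twist hf hQ h3 hd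
  have hmp : m.Prime := hm.out
  haveI : NeZero m := ⟨hmp.ne_zero⟩
  have hm3 : ¬ 3 ∣ m.totient := by
    rw [Nat.totient_prime hmp]
    have h3m : 3 ∣ m + 1 := dvd_trans h3 (nat_dvd_succ_of_zmod_eq_neg_one hmN)
    have h1m := hmp.one_le
    intro h
    omega
  refine ⟨m, inferInstance, χ, r, ?_, DirichletCharacter.isPrimitive_of_prime hχ1, hχ1,
    fun h ↦ hm3 (dvd_trans h (DirichletCharacter.orderOf_dvd_totient χ)), hev, hr, hu⟩
  exact (Nat.Prime.coprime_iff_not_dvd hmp).mpr fun h ↦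
    absurd (Nat.le_of_dvd (Nat.mul_pos (by norm_num) (NeZero.pos N)) h) (not_le.mpr hmn)

/-- **E-es-87♭⁺ at `4 ∣ N` — PROVED**: as E-es-87♭ with the twist of ODD order (`m ≡ −1 (mod N)` and `4 ∣ N` force
`m ≡ 3 (mod 4)`, and an even `χ` has `ord χ ∣ (m−1)/2`, odd).  For odd `N` the odd-order clause of es's
`OddTameUnitTwistOfPlusIndexPrimeToThree` needs the variant B″ of THEOREM B′ (prime class mod `4N`), not proved here. -/
theorem oddTameUnitTwistOfPlusIndexPrimeToThree_of_four_dvd {N : ℕ} [NeZero N] (f : CuspForm (Gamma0 N) 2)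
    (hf : IsNewform0 f) (hQ : coeffField f = ⊥) (h3 : 3 ∣ N) (h4 : 4 ∣ N) (hd : PlusIndexPrimeTo 3 f) :
    ∃ (m : ℕ) (_ : NeZero m) (χ : DirichletCharacter ℂ m) (r : ℂ),
      m.Coprime (3 * N) ∧ χ.IsPrimitive ∧ χ ≠ 1 ∧ Odd (orderOf χ) ∧ ¬ 3 ∣ orderOf χ ∧ χ.Even ∧
      twistedSymbolSum f χ = r * (plusPeriod f : ℂ) ∧
      ∀ s : ℕ, ¬ 3 ∣ s → ¬ _root_.IsIntegral ℤ ((s : ℂ) * r / 3) := by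
  obtain ⟨m, hm, χ, r, hmn, hmN, hχ1, hev, hr, hu⟩ := exists_prime_even_character_unit_twist hf hQ h3 hd
  have hmp : m.Prime := hm.out
  haveI : NeZero m := ⟨hmp.ne_zero⟩
  have hmod : N ∣ m + 1 := nat_dvd_succ_of_zmod_eq_neg_one hmN
  have hm3 : ¬ 3 ∣ m.totient := by
    rw [Nat.totient_prime hmp]
    have h3m : 3 ∣ m + 1 := dvd_trans h3 hmod
    have h1m := hmp.one_le
    intro h
    omega
  -- `m ≡ 3 (mod 4)`, so `m / 2` is odd
  have hodd : Odd (m / 2) := by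
    have h4m : 4 ∣ m + 1 := dvd_trans h4 hmod
    rw [Nat.odd_iff]
    omega
  refine ⟨m, inferInstance, χ, r, ?_, DirichletCharacter.isPrimitive_of_prime hχ1, hχ1,
    hodd.of_dvd_nat (DirichletCharacter.orderOf_dvd_div_two_of_even hev),
    fun h ↦ hm3 (dvd_trans h (DirichletCharacter.orderOf_dvd_totient χ)), hev, hr, hu⟩
  exact (Nat.Prime.coprime_iff_not_dvd hmp).mpr fun h ↦
    absurd (Nat.le_of_dvd (Nat.mul_pos (by norm_num) (NeZero.pos N)) h) (not_le.mpr hmn)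

end Summit.BirchSwinnertonDyer.BirchSwinnertonDyer.Theorems.ManinLocalTwoThree

end
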